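import Summits.AtomisticToContinuum.Crystallization.Theorems.SquareWellLayerCakeGapTwelveToBarlowFiveRingCensusSound

/-!
# Five-ring shell census: extraction of the S2β stubs from the census claim

Crux `SquareWellLayerCake.GapTwelveToBarlow` (stmt-AtomisticToContinuum-15807), line `Sketch`,
stubs `stub_fiveFoldExists` / `stub_fiveFoldNoAdjacent` (S2β), GENERIC in the closeness `η` and
the anchor tables `A` of the five-ring census (`…FiveRingCensusDefs`, `…FiveRingCensusSound`).

From the hypotheses of the stubs — a Good site `j` (twelve neighbours within `1`, hard core
`55/57` around every site within `11/10`), the local dichotomy at `j` (two neighbours of `j` are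
`≤ 1` or `≥ 131/100` apart) and a five-fold bond `(j, k)` (exactly five common neighbours) — we
label the twelve neighbours `e : Fin 12 → Fin N` with `e 0 = k`, `e 1, …, e 5` the ring of
`(j, k)` and `e 6, …, e 11` the six other neighbours (`exists_fiveRing_labelling`), and show
that the relative tuple `m ↦ x (e m) − x j` is an admissible tuple of `fiveRingSpec η A`
satisfying the pole constraints `fiveRingConstraints.take 11` (`exists_fiveRing_tuple`); common
neighbours of `j` and `e m` are counted by the contact degree of the label `m`
(`card_common_eq_card_bonded`).  With `poles_of_fiveRingClaim` this gives the two registered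
extraction theorems

* `fiveFoldExists_of_claim`: forcing test + census claim ⇒ `stub_fiveFoldExists`;
* `fiveFoldNoAdjacent_of_claim`: forcing test + census claim ⇒ `stub_fiveFoldNoAdjacent`.

The census claim itself (a replayed certificate, `Census.checkFrom_sound`) is a sibling file.
Mathlib + the two census files only; no named fact is used.
-/

noncomputable section

namespace Summit.AtomisticToContinuum.Crystallization.Theorems.SquareWellLayerCakeGapTwelveToBarlow

open Literature.Geometry.DiscreteGeometry Literature.Geometry.DiscreteGeometry.ShellCensus Finset

/-! ### Labelling the twelve neighbours -/

/-- **Labelling of the twelve neighbours** of a site `j` with twelve neighbours, adapted to a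
five-fold bond `(j, k)`: an injective `e : Fin 12 → Fin N` onto the neighbours of `j` with
`e 0 = k`, the labels `1, …, 5` sent into the ring of `(j, k)` (bonded to `k`) and the labels
`6, …, 11` to the other neighbours (not `k`, not bonded to `k`). -/
theorem exists_fiveRing_labelling {N : ℕ} (x : Fin N → EuclideanSpace ℝ (Fin 3)) (j k : Fin N)
    (hN : (univ.filter fun j' : Fin N => j' ≠ j ∧ dist (x j) (x j') ≤ 1).card = 12)
    (hjk : j ≠ k) (hk : dist (x j) (x k) ≤ 1)
    (hR : (univ.filter fun l : Fin N =>
      l ≠ j ∧ l ≠ k ∧ dist (x j) (x l) ≤ 1 ∧ dist (x k) (x l) ≤ 1).card = 5) :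
    ∃ e : Fin 12 → Fin N, Function.Injective e ∧ e 0 = k ∧
      (∀ m, e m ≠ j ∧ dist (x j) (x (e m)) ≤ 1) ∧
      (∀ l : Fin N, l ≠ j → dist (x j) (x l) ≤ 1 → ∃ m, e m = l) ∧
      (∀ m : Fin 12, 1 ≤ (m : ℕ) → (m : ℕ) ≤ 5 → dist (x k) (x (e m)) ≤ 1) ∧
      (∀ m : Fin 12, 6 ≤ (m : ℕ) → e m ≠ k ∧ ¬ dist (x k) (x (e m)) ≤ 1) := by
  classical
  -- the three parts of the neighbourhood: `{k}`, the ring `R`, the others `O`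
  set Nb := univ.filter fun j' : Fin N => j' ≠ j ∧ dist (x j) (x j') ≤ 1 with hNb
  set R := univ.filter fun l : Fin N =>
    l ≠ j ∧ l ≠ k ∧ dist (x j) (x l) ≤ 1 ∧ dist (x k) (x l) ≤ 1 with hRd
  have hkNb : k ∈ Nb := by
    rw [hNb, mem_filter]; exact ⟨mem_univ _, hjk.symm, hk⟩
  have hRNb : R ⊆ Nb := by
    intro l hl
    rw [hRd, mem_filter] at hl
    rw [hNb, mem_filter]
    exact ⟨mem_univ _, hl.2.1, hl.2.2.2.1⟩
  have hkR : k ∉ R := by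
    rw [hRd, mem_filter]
    simp
  set O := Nb \ insert k R with hOd
  have hO6 : O.card = 6 := by
    have h1 : (insert k R).card = 6 := by rw [card_insert_of_notMem hkR, hR]
    rw [hOd, card_sdiff_of_subset (insert_subset hkNb hRNb), hN, h1]
  -- the labelling
  obtain ⟨e, he⟩ : ∃ e : Fin 12 → Fin N, ∀ m : Fin 12, e m =
      if (m : ℕ) = 0 then k else
        if h5 : (m : ℕ) ≤ 5 then R.orderEmbOfFin hR ⟨(m : ℕ) - 1, by omega⟩
        else O.orderEmbOfFin hO6 ⟨(m : ℕ) - 6, by have := m.isLt; omega⟩ :=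
    ⟨_, fun _ => rfl⟩
  have he0 : e 0 = k := by rw [he]; simp
  have heR : ∀ m : Fin 12, (m : ℕ) ≠ 0 → (m : ℕ) ≤ 5 → e m ∈ R := by
    intro m h0 h5
    rw [he, if_neg h0, dif_pos h5]
    exact orderEmbOfFin_mem _ _ _
  have heO : ∀ m : Fin 12, ¬ (m : ℕ) ≤ 5 → e m ∈ O := by
    intro m h5
    rw [he, if_neg (by omega), dif_neg h5]
    exact orderEmbOfFin_mem _ _ _
  have hOsub : O ⊆ Nb := sdiff_subset
  have heNb : ∀ m, e m ∈ Nb := by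
    intro m
    by_cases h0 : (m : ℕ) = 0
    · have hm : m = 0 := Fin.ext h0
      rw [hm, he0]
      exact hkNb
    by_cases h5 : (m : ℕ) ≤ 5
    · exact hRNb (heR m h0 h5)
    · exact hOsub (heO m h5)
  -- surjectivity onto the neighbourhood
  have hsurj : ∀ l ∈ Nb, ∃ m, e m = l := by
    intro l hl
    by_cases hlk : l = k
    · exact ⟨0, by rw [he0, hlk]⟩
    by_cases hlR : l ∈ R
    · have hl' : l ∈ Set.range (R.orderEmbOfFin hR) := by
        rw [range_orderEmbOfFin]; exact hlR
      obtain ⟨i, hi⟩ := hl'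
      refine ⟨⟨(i : ℕ) + 1, by omega⟩, ?_⟩
      have h5 : (i : ℕ) + 1 ≤ 5 := by omega
      rw [he]
      simp [h5, hi]
    · have hlO : l ∈ O := by
        rw [hOd, mem_sdiff, mem_insert]
        exact ⟨hl, fun h => h.elim hlk hlR⟩
      have hl' : l ∈ Set.range (O.orderEmbOfFin hO6) := by
        rw [range_orderEmbOfFin]; exact hlO
      obtain ⟨i, hi⟩ := hl'
      refine ⟨⟨(i : ℕ) + 6, by omega⟩, ?_⟩
      have h5 : ¬ (i : ℕ) + 6 ≤ 5 := by omega
      rw [he]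
      simp [h5, hi]
  -- injectivity by counting
  have himage : univ.image e = Nb := by
    ext l
    simp only [mem_image, mem_univ, true_and]
    exact ⟨fun ⟨m, hm⟩ => hm ▸ heNb m, fun hl => hsurj l hl⟩
  have hinj : Function.Injective e := by
    have hc : (univ.image e).card = (univ : Finset (Fin 12)).card := by
      rw [himage, hN, card_univ, Fintype.card_fin]
    have h := card_image_iff.1 hc
    simpa using h
  refine ⟨e, hinj, he0, ?_, ?_, ?_, ?_⟩
  · intro m
    have h := heNb m
    rw [hNb, mem_filter] at h
    exact h.2
  · intro l hlj hld
    exact hsurj l (by rw [hNb, mem_filter]; exact ⟨mem_univ _, hlj, hld⟩)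
  · intro m h1 h5
    have h := heR m (by omega) h5
    rw [hRd, mem_filter] at h
    exact h.2.2.2.2
  · intro m h6
    have hm := heO m (by omega)
    rw [hOd, mem_sdiff, mem_insert, not_or] at hm
    refine ⟨hm.2.1, fun hd => hm.2.2 ?_⟩
    have hmNb := hm.1
    rw [hNb, mem_filter] at hmNb
    rw [hRd, mem_filter]
    exact ⟨mem_univ _, hmNb.2.1, hm.2.1, hmNb.2.2, hd⟩

/-! ### The census tuple of a five-fold bond -/

/-- **The relative tuple of a labelling is admissible** for `fiveRingSpec η A`: norms in
`[55/57, 1]` (hard core at `j`, neighbours within `1`), pairwise hard core `55/57` (the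
neighbours are within `11/10` of `j`), distinct points, and the bond-or-far alternative (the
local dichotomy at `j`). -/
theorem admissible_of_labelling {N : ℕ} (x : Fin N → EuclideanSpace ℝ (Fin 3)) (j : Fin N)
    (hG : ∀ j' : Fin N, dist (x j) (x j') ≤ 11 / 10 → ∀ k' : Fin N, k' ≠ j' →
      (55 : ℝ) / 57 ≤ dist (x j') (x k'))
    (hD : ∀ l l' : Fin N, dist (x j) (x l) ≤ 1 → dist (x j) (x l') ≤ 1 → 1 < dist (x l) (x l') →
      (131 : ℝ) / 100 ≤ dist (x l) (x l'))
    {e : Fin 12 → Fin N} (hinj : Function.Injective e)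
    (hNb : ∀ m, e m ≠ j ∧ dist (x j) (x (e m)) ≤ 1) (η : ℚ) (A : List (List (ℚ × ℚ × ℚ))) :
    (fiveRingSpec η A).Admissible (fun m => x (e m) - x j) := by
  have hcore : ∀ a b : Fin 12, a ≠ b → (55 : ℝ) / 57 ≤ dist (x (e a)) (x (e b)) := by
    intro a b hab
    have h11 : dist (x j) (x (e a)) ≤ 11 / 10 := by linarith [(hNb a).2]
    exact hG (e a) h11 (e b) (fun h => hab (hinj h).symm)
  refine ⟨?_, ?_, ?_, ?_, ?_⟩
  · intro a b hab
    by_contra hne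
    have h := hcore a b hne
    have hab' : x (e a) - x j = x (e b) - x j := hab
    rw [sub_left_inj] at hab'
    rw [hab', dist_self] at h
    norm_num at h
  · intro m
    show (((55 / 57 : ℚ)) : ℝ) ≤ ‖x (e m) - x j‖
    rw [← dist_eq_norm, dist_comm]
    have h := hG j (by rw [dist_self]; norm_num) (e m) (hNb m).1
    push_cast
    exact h
  · intro m
    show ‖x (e m) - x j‖ ≤ (((1 : ℚ)) : ℝ)
    rw [← dist_eq_norm, dist_comm, Rat.cast_one]
    exact (hNb m).2
  · intro a b hab
    show (((55 / 57 : ℚ)) : ℝ) ≤ dist (x (e a) - x j) (x (e b) - x j)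
    rw [dist_sub_right]
    push_cast
    exact hcore a b hab
  · intro a b hab
    show dist (x (e a) - x j) (x (e b) - x j) ≤ (((1 : ℚ)) : ℝ) ∨
      (((131 / 100 : ℚ)) : ℝ) ≤ dist (x (e a) - x j) (x (e b) - x j)
    rw [dist_sub_right]
    push_cast
    by_cases h1 : dist (x (e a)) (x (e b)) ≤ 1
    · exact Or.inl h1
    · exact Or.inr (hD (e a) (e b) (hNb a).2 (hNb b).2 (lt_of_not_ge h1))

/-- **The census tuple of a five-fold bond.**  At a site `j` with twelve neighbours, hard core
`55/57` around every site within `11/10` of `j` and the local `131/100` dichotomy, a five-fold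
bond `(j, k)` yields a labelling `e` of the neighbours of `j` (`e 0 = k`, onto, injective) whose
relative tuple `m ↦ x (e m) − x j` is admissible for `fiveRingSpec η A` and satisfies the pole
constraints `fiveRingConstraints.take 11` (ring labels bonded to `k`; the other labels are
neighbours of `j` not bonded to `k`, hence `≥ 131/100` from `k` by the dichotomy). -/
theorem exists_fiveRing_tuple (η : ℚ) (A : List (List (ℚ × ℚ × ℚ))) {N : ℕ}
    (x : Fin N → EuclideanSpace ℝ (Fin 3)) (j k : Fin N)
    (hG : ∀ j' : Fin N, dist (x j) (x j') ≤ 11 / 10 → ∀ k' : Fin N, k' ≠ j' →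
      (55 : ℝ) / 57 ≤ dist (x j') (x k'))
    (hN : (univ.filter fun j' : Fin N => j' ≠ j ∧ dist (x j) (x j') ≤ 1).card = 12)
    (hD : ∀ l l' : Fin N, dist (x j) (x l) ≤ 1 → dist (x j) (x l') ≤ 1 → 1 < dist (x l) (x l') →
      (131 : ℝ) / 100 ≤ dist (x l) (x l'))
    (hjk : j ≠ k) (hk : dist (x j) (x k) ≤ 1)
    (hR : (univ.filter fun l : Fin N =>
      l ≠ j ∧ l ≠ k ∧ dist (x j) (x l) ≤ 1 ∧ dist (x k) (x l) ≤ 1).card = 5) :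
    ∃ e : Fin 12 → Fin N, Function.Injective e ∧ e 0 = k ∧
      (∀ m, e m ≠ j ∧ dist (x j) (x (e m)) ≤ 1) ∧
      (∀ l : Fin N, l ≠ j → dist (x j) (x l) ≤ 1 → ∃ m, e m = l) ∧
      (fiveRingSpec η A).Admissible (fun m => x (e m) - x j) ∧
      (fiveRingSpec η A).Sat (fiveRingConstraints.take 11) (fun m => x (e m) - x j) := by
  obtain ⟨e, hinj, he0, hNb, hsurj, hring, hother⟩ := exists_fiveRing_labelling x j k hN hjk hk hR
  refine ⟨e, hinj, he0, hNb, hsurj, admissible_of_labelling x j hG hD hinj hNb η A, ?_⟩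
  refine sat_take_of_bond_far ?_ ?_
  · intro m h1 h5
    show dist (x (e 0) - x j) (x (e m) - x j) ≤ 1
    rw [dist_sub_right, he0]
    exact hring m h1 h5
  · intro m h6
    show (131 : ℝ) / 100 ≤ dist (x (e 0) - x j) (x (e m) - x j)
    rw [dist_sub_right, he0]
    exact hD k (e m) hk (hNb m).2 (lt_of_not_ge (hother m h6).2)

/-- **Transport of common-neighbour counts.**  For a labelling `e` of the neighbours of `j`
(injective, onto), the common neighbours of `j` and `e m` are counted by the contact degree of
the label `m` in the relative tuple. -/
theorem card_common_eq_card_bonded {N : ℕ} (x : Fin N → EuclideanSpace ℝ (Fin 3)) (j : Fin N)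
    {e : Fin 12 → Fin N} (hinj : Function.Injective e)
    (hNb : ∀ m, e m ≠ j ∧ dist (x j) (x (e m)) ≤ 1)
    (hsurj : ∀ l : Fin N, l ≠ j → dist (x j) (x l) ≤ 1 → ∃ m, e m = l) (m : Fin 12) :
    (univ.filter fun l : Fin N =>
        l ≠ j ∧ l ≠ e m ∧ dist (x j) (x l) ≤ 1 ∧ dist (x (e m)) (x l) ≤ 1).card =
      (univ.filter fun m' : Fin 12 =>
        m' ≠ m ∧ dist (x (e m) - x j) (x (e m') - x j) ≤ 1).card := by
  classical
  have hset : (univ.filter fun l : Fin N =>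
      l ≠ j ∧ l ≠ e m ∧ dist (x j) (x l) ≤ 1 ∧ dist (x (e m)) (x l) ≤ 1) =
      (univ.filter fun m' : Fin 12 =>
        m' ≠ m ∧ dist (x (e m) - x j) (x (e m') - x j) ≤ 1).map ⟨e, hinj⟩ := by
    ext l
    simp only [mem_filter, mem_univ, true_and, mem_map, Function.Embedding.coeFn_mk,
      dist_sub_right]
    constructor
    · rintro ⟨hlj, hlm, hjl, hml⟩
      obtain ⟨m', rfl⟩ := hsurj l hlj hjl
      exact ⟨m', ⟨fun h => hlm (congrArg e h), hml⟩, rfl⟩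
    · rintro ⟨m', ⟨hm'm, hd⟩, rfl⟩
      exact ⟨(hNb m').1, fun h => hm'm (hinj h), (hNb m').2, hd⟩
  rw [hset, card_map]

/-! ### The two stubs from the census claim -/

/-- **`stub_fiveFoldExists` from the five-ring census** (S2β-EX, line `Sketch`): if the anchor
tables `A` pass the forcing test at closeness `η` and the census claim holds for the pole
constraints, then a Good site with the local `131/100` dichotomy carrying one five-fold bond
`(j, k)` carries a second one `(j, k')` — the other pole of the forced bicapped pentagonal
prism (`poles_of_fiveRingClaim`). -/
theorem fiveFoldExists_of_claim :
    ∀ (η : ℚ) (A : List (List (ℚ × ℚ × ℚ))), bppForcingB η A = true →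
      (fiveRingSpec η A).Claim (anchorPatterns η A) (fiveRingConstraints.take 11) →
      ∀ (N : ℕ) (x : Fin N → EuclideanSpace ℝ (Fin 3)) (j k : Fin N),
        ((∀ j' : Fin N, dist (x j) (x j') ≤ 11 / 10 → ∀ k' : Fin N, k' ≠ j' →
            (55 : ℝ) / 57 ≤ dist (x j') (x k')) ∧
          (Finset.univ.filter fun j' : Fin N => j' ≠ j ∧ dist (x j) (x j') ≤ 1).card = 12 ∧
          (Finset.univ.filter fun j' : Fin N => j' ≠ j ∧ dist (x j) (x j') ≤ 11 / 10).card ≤ 12) →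
        (∀ l l' : Fin N, dist (x j) (x l) ≤ 1 → dist (x j) (x l') ≤ 1 → 1 < dist (x l) (x l') →
          (131 : ℝ) / 100 ≤ dist (x l) (x l')) →
        j ≠ k → dist (x j) (x k) ≤ 1 →
        (Finset.univ.filter fun l : Fin N =>
          l ≠ j ∧ l ≠ k ∧ dist (x j) (x l) ≤ 1 ∧ dist (x k) (x l) ≤ 1).card = 5 →
        ∃ k' : Fin N, k' ≠ j ∧ k' ≠ k ∧ dist (x j) (x k') ≤ 1 ∧
          (Finset.univ.filter fun l : Fin N =>
            l ≠ j ∧ l ≠ k' ∧ dist (x j) (x l) ≤ 1 ∧ dist (x k') (x l) ≤ 1).card = 5 := by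
  intro η A hF hC N x j k hGood hD hjk hk hR5
  obtain ⟨e, hinj, he0, hNb, hsurj, ht, hS⟩ :=
    exists_fiveRing_tuple η A x j k hGood.1 hGood.2.1 hD hjk hk hR5
  obtain ⟨⟨k', hk'0, hdeg⟩, -⟩ := poles_of_fiveRingClaim η A hF hC _ ht hS
  refine ⟨e k', (hNb k').1, fun h => hk'0 (hinj (h.trans he0.symm)), (hNb k').2, ?_⟩
  rw [card_common_eq_card_bonded x j hinj hNb hsurj k']
  exact hdeg

/-- **`stub_fiveFoldNoAdjacent` from the five-ring census** (S2β-ADJ, line `Sketch`): if the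
anchor tables `A` pass the forcing test at closeness `η` and the census claim holds for the pole
constraints, then two five-fold bonds `(j, k)`, `(j, k')` at a Good site with the local `131/100`
dichotomy are never bonded to each other — both are poles of the forced bicapped pentagonal
prism, and the poles are not adjacent (`poles_of_fiveRingClaim`). -/
theorem fiveFoldNoAdjacent_of_claim :
    ∀ (η : ℚ) (A : List (List (ℚ × ℚ × ℚ))), bppForcingB η A = true →
      (fiveRingSpec η A).Claim (anchorPatterns η A) (fiveRingConstraints.take 11) →
      ∀ (N : ℕ) (x : Fin N → EuclideanSpace ℝ (Fin 3)) (j k : Fin N),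
        ((∀ j' : Fin N, dist (x j) (x j') ≤ 11 / 10 → ∀ k' : Fin N, k' ≠ j' →
            (55 : ℝ) / 57 ≤ dist (x j') (x k')) ∧
          (Finset.univ.filter fun j' : Fin N => j' ≠ j ∧ dist (x j) (x j') ≤ 1).card = 12 ∧
          (Finset.univ.filter fun j' : Fin N => j' ≠ j ∧ dist (x j) (x j') ≤ 11 / 10).card ≤ 12) →
        (∀ l l' : Fin N, dist (x j) (x l) ≤ 1 → dist (x j) (x l') ≤ 1 → 1 < dist (x l) (x l') →
          (131 : ℝ) / 100 ≤ dist (x l) (x l')) →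
        j ≠ k → dist (x j) (x k) ≤ 1 →
        (Finset.univ.filter fun l : Fin N =>
          l ≠ j ∧ l ≠ k ∧ dist (x j) (x l) ≤ 1 ∧ dist (x k) (x l) ≤ 1).card = 5 →
        ∀ k' : Fin N, k' ≠ j → k' ≠ k → dist (x j) (x k') ≤ 1 →
          (Finset.univ.filter fun l : Fin N =>
            l ≠ j ∧ l ≠ k' ∧ dist (x j) (x l) ≤ 1 ∧ dist (x k') (x l) ≤ 1).card = 5 →
          1 < dist (x k) (x k') := by
  intro η A hF hC N x j k hGood hD hjk hk hR5 k' hk'j hk'k hk' hR5'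
  obtain ⟨e, hinj, he0, hNb, hsurj, ht, hS⟩ :=
    exists_fiveRing_tuple η A x j k hGood.1 hGood.2.1 hD hjk hk hR5
  obtain ⟨-, hfar⟩ := poles_of_fiveRingClaim η A hF hC _ ht hS
  obtain ⟨m, hm⟩ := hsurj k' hk'j hk'
  have hm0 : m ≠ 0 := fun h => hk'k (by rw [← hm, h, he0])
  have hdeg : (univ.filter fun m' : Fin 12 =>
      m' ≠ m ∧ dist (x (e m) - x j) (x (e m') - x j) ≤ 1).card = 5 := by
    rw [← card_common_eq_card_bonded x j hinj hNb hsurj m, hm]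
    exact hR5'
  have h := hfar m hm0 hdeg
  have h' : 1 < dist (x (e 0) - x j) (x (e m) - x j) := h
  rwa [dist_sub_right, he0, hm] at h'

end Summit.AtomisticToContinuum.Crystallization.Theorems.SquareWellLayerCakeGapTwelveToBarlow

end
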